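import Literature.IUT.HodgeArakelov.MonoThetaProjective
import Literature.AnabelianGeometry.SemiGraphs.TemperedAnabelian
import Literature.AnabelianGeometry.AbsoluteAnabelian.AbsTopII.EllipticCuspidalization
import HarnessLib

/-!
# [IUTchII] Prop. 1.6 (i): the successor predicate pinning the reference inclusion `inclRef` to the `k`-CORE
# `Π^tp_{X̲̲_k} ⊆ Π^tp_{C_k}` of [AbsTopII] Cor. 3.3 (i) (tempered reading + profinite output of record)

Statement-only SUCCESSOR file (one `Prop`-valued structure, one bundled structure, one plumbing `def`; no edit of the
frozen `MonoThetaProjective.lean` p407497, no new named fact) of the abc-iut cell, wave-5 seat abc-iut-w5-d030 (gen 9),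
for the DAG node **IUTchII:Prop1.6(i)** (layer L6, OUTSIDE the [IUTchIII] Cor. 3.12 cone) — the symmetric twin of the
node-(ii) successor `MonoThetaProjectiveProp16EllipticRef.lean` (`EllipticCuspidalization.RefIsElliptic`, p437894):
the frozen output `CoreData S P` carries the reference datum `PiCRef`, `inclRef : S.PiX →* PiCRef` as an
unconstrained interface stand-in (MERGE-MAP row 91: "the GENUINE tempered core `Π^tp_{C_k}` is not in the tree"; kernel
form `CoreData.nonempty_iff`, p412824); this file pins it.

S. Mochizuki, *Inter-universal Teichmüller Theory II*, kurims manuscript (Dec. 2020), §1, Prop. 1.6 (i) p. 31 l. 16–33,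
read on the page: "(Cores) There exists a functorial group-theoretic algorithm [cf. [AbsTopII], Corollary 3.3, (i);
[AbsTopII], Remark 3.3.3] `Π ↦ {(Π ⊆) Π_C(Π) ↠ Π/Δ}` … in a fashion that is compatible with the respective surjections
to `Π/Δ` and which satisfies the property that when `Π = Π^tp_{X̲̲_k}`, the inclusion `Π ⊆ Π_C(Π)` may be naturally
identified with the inclusion `Π^tp_{X̲̲_k} ⊆ Π^tp_{C_k}`." [claim: Mochizuki2012, status: disputed] (IUTchII §1 Prop 1.6
(i), kurims p.31) — `X̲̲_k → C_k` being "the `k`-core determined by `X̲̲_k`" (p. 20). S. Mochizuki, *Topics in Absolute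
Anabelian Geometry II*, Cor. 3.3 (i) p. 68 (the `k'`-core `Π' ⇝ Π_C`, "the unique chain of length 1 in `Chain(Π')`,
with associated type-chain `⋎`"), Rmk. 3.3.3 p. 69 ("Corollary 3.3 admits a 'tempered version', when the base field
`k` is an MLF") [cite: MochizukiAbsTopII2013, Cor 3.3 (i) p.68]; [SemiAnbd] §6 pp. 69–74 (tempered fundamental groups of
hyperbolic curves over MLF's, profinite completions) [cite: MochizukiSemiAnbd2006, §6 pp.69-74].

## What is typed

* **`CoreData.RefIsCore Cd X C eX eC`** — for tempered curves `X` (playing `X̲̲_k`) and `C` (playing the `k`-core `C_k`)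
  with identifications `eX : Π^tp_X ≃ₜ* S.PiX`, `eC : Π^tp_C ≃ₜ* Cd.PiCRef`:
  (R0) "`Π = Π^tp_{X̲̲_k}`" — `eX` carries `Δ^tp_X` onto the setting's `Δ^tp_{X̲̲_k} = Ker(S.aug)`;
  (R1) TEMPERED FINITE ÉTALE COVERING `X̲̲_k → C_k` OVER `k` ([AbsTopII] Rmk. 3.3.3's tempered version; [SemiAnbd] §6):
  same base field, the reference inclusion read on the curves `Π^tp_X → Π^tp_C` is continuous, an OPEN EMBEDDING of
  FINITE INDEX, and lies over the augmentations;
  (R2) `k`-CORE via the L4 output of record: an extension `E` with `E.arith ≃ₜ* Π̂_X` (matching `Δ̂_X`), an [AbsTopII]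
  Cor. 3.3 record `R : AbsTopII.EllipticCuspidalization E` whose CORE `R.core` ("the `k'`-core", Cor. 3.3 (i)) is
  identified with `Π̂_C`, `iC : Π̂_C ≃ₜ* R.core.arith`, making the completion square `toHat_C ∘ inclRef' = R.toCore.arith ∘
  toHat_X` commute.
* **`CoreData.Genuine S P X C eX`** `extends CoreData S P` by `eC` and `refIsCore` — the decl-for-decl replacement of
  the reference stand-in, as for node (ii) (`EllipticCuspidalization.Genuine`, p439458); `CoreData.refIncl` — the
  reference inclusion read on the curves, `eC⁻¹ ∘ inclRef ∘ eX`.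

HONEST SCOPE: a PREDICATE/structure over interface data (`SemiGraphs.TemperedCurve p`); inhabiting it at the [EtTh]
model needs the tempered fundamental group of the core `C_k` with `Π^tp_{X̲̲_k} ↪ Π^tp_{C_k}` (the MERGE debt of row
91, unchanged); the interface-level witness of p412824 (`Π_C(Π) := Π`) is NOT claimed to satisfy it. Nothing here takes
a side on [IUTchIII] Cor. 3.12; typed ≠ proved; constructed ≠ the paper's reconstruction algorithms.
-/

open Topology

universe u

namespace Literature.IUT.HodgeArakelov

open Literature.AnabelianGeometry.SemiGraphs (TemperedCurve)
open Literature.AnabelianGeometry.AbsoluteAnabelian (FundamentalExtension)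

namespace CoreData

variable {S : ThetaSetting.{u}} {P : TopGroup.{u}} {p : ℕ} [Fact p.Prime]

/-- The reference inclusion READ ON TEMPERED CURVES: `Π^tp_X → Π^tp_C` obtained from `inclRef` through the
identifications `eX : Π^tp_X ≃ₜ* Π^tp_{X̲̲_k}` (the setting's group) and `eC : Π^tp_C ≃ₜ* Π^tp_{C_k}` (reference side of
the output). [claim: Mochizuki2012, status: disputed] (IUTchII §1 Prop 1.6 (i), kurims p.31) -/
def refIncl (Cd : CoreData S P) (X C : TemperedCurve p) (eX : X.PiTemp ≃ₜ* S.PiX) (eC : C.PiTemp ≃ₜ* Cd.PiCRef) :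
    X.PiTemp →* C.PiTemp :=
  eC.symm.toMulEquiv.toMonoidHom.comp (Cd.inclRef.comp eX.toMulEquiv.toMonoidHom)

/-- `refIncl` unfolds to `eC⁻¹ ∘ inclRef ∘ eX`. [claim: Mochizuki2012, status: disputed] (IUTchII §1 Prop 1.6 (i), kurims p.31) -/
theorem refIncl_apply (Cd : CoreData S P) (X C : TemperedCurve p) (eX : X.PiTemp ≃ₜ* S.PiX)
    (eC : C.PiTemp ≃ₜ* Cd.PiCRef) (x : X.PiTemp) :
    Cd.refIncl X C eX eC x = eC.symm (Cd.inclRef (eX x)) := rfl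

/-- **THE SUCCESSOR PREDICATE of IUTchII:Prop1.6(i).** For the frozen output `Cd : CoreData S P` over the setting `S`,
tempered curves `X` ("`Π = Π^tp_{X̲̲_k}`") and `C` (the `k`-core `C_k`) with identifications `eX`, `eC`: the reference
inclusion `inclRef` IS `Π^tp_{X̲̲_k} ⊆ Π^tp_{C_k}` — (R0) `eX` carries `Δ^tp_X` onto `Ker(S.aug)`; (R1) at the tempered
[SemiAnbd] §6 interface, a continuous OPEN EMBEDDING of finite index over the augmentations of two curves over the
same field (the finite étale covering `X̲̲_k → C_k`; [AbsTopII] Rmk. 3.3.3's "tempered version"); (R2) at the profinite level its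
completion IS the CORE `Π' ↪ Π_C` of abc-iut-L4-t6's [AbsTopII] Cor. 3.3 output record ("the `k'`-core", Cor. 3.3 (i)).
A `Prop`; never asserted; to be inhabited at genuine models and consumed BY NAME.
[cite: MochizukiAbsTopII2013, Cor 3.3 (i) p.68]
[claim: Mochizuki2012, status: disputed] (IUTchII §1 Prop 1.6 (i), kurims p.31) -/
structure RefIsCore (Cd : CoreData S P) (X C : TemperedCurve p) (eX : X.PiTemp ≃ₜ* S.PiX)
    (eC : C.PiTemp ≃ₜ* Cd.PiCRef) : Prop where
  /-- "`Π = Π^tp_{X̲̲_k}`": `eX` carries `Δ^tp_X` onto the setting's `Δ^tp_{X̲̲_k} = Ker(S.aug)` -/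
  deltaTemp_eq : X.DeltaTemp.map eX.toMulEquiv.toMonoidHom = S.DeltaX
  /-- `X̲̲_k` and its `k`-core `C_k` are curves over the same field `k` -/
  K_eq : C.K = X.K
  /-- the reference inclusion is continuous … -/
  continuous_inclRef : Continuous Cd.inclRef
  /-- … an open embedding (`Π^tp_{X̲̲_k}` is an open subgroup of `Π^tp_{C_k}`: a finite étale covering) … -/
  isOpenEmbedding_refIncl : IsOpenEmbedding (Cd.refIncl X C eX eC)
  /-- … of FINITE index (`X̲̲_k → C_k` is a finite étale covering) … -/
  finiteIndex_range : (Cd.refIncl X C eX eC).range.FiniteIndex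
  /-- … and lies over the augmentations to `G_k ≤ G_{ℚ_p}` (a covering OVER `k`) -/
  aug_comp : ∀ x : X.PiTemp, C.aug (Cd.refIncl X C eX eC x) = X.aug x
  /-- (R2) THE CORE via the L4 output of record: the profinite completion of `Π^tp_X ↪ Π^tp_C` IS the `k'`-core
  `Π' ↪ Π_C` of an [AbsTopII] Cor. 3.3 record over an extension identified with `Π̂_X` (matching `Δ̂_X`) -/
  core : ∃ (E : FundamentalExtension.{0}) (iX : X.PiHat ≃ₜ* E.arith)
      (R : Literature.AnabelianGeometry.AbsoluteAnabelian.AbsTopII.EllipticCuspidalization E)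
      (iC : C.PiHat ≃ₜ* R.core.arith),
    (∀ z : X.PiHat, iX z ∈ E.geom ↔ z ∈ X.DeltaHat) ∧
      ∀ x : X.PiTemp, R.toCore.arith (iX (X.toHat x)) = iC (C.toHat (Cd.refIncl X C eX eC x))

end CoreData

/-- **IUTchII:Prop1.6(i), GENUINE OUTPUT** ("Cores", kurims p. 31): the frozen output `CoreData S P` extended,
decl-for-decl on its reference side, by the identification `eC : Π^tp_C ≃ₜ* PiCRef` with the tempered group of the
`k`-core and the successor predicate `RefIsCore X C eX eC` — "when `Π = Π^tp_{X̲̲_k}`, the inclusion `Π ⊆ Π_C(Π)` may be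
naturally identified with the inclusion `Π^tp_{X̲̲_k} ⊆ Π^tp_{C_k}`". A structure over the tree's interfaces; never
asserted to be inhabited. [claim: Mochizuki2012, status: disputed] (IUTchII §1 Prop 1.6 (i), kurims p.31) -/
structure CoreData.Genuine (S : ThetaSetting.{u}) (P : TopGroup.{u}) {p : ℕ} [Fact p.Prime] (X C : TemperedCurve p)
    (eX : X.PiTemp ≃ₜ* S.PiX) extends CoreData S P where
  /-- the reference side `Π^tp_{C_k}` IS the tempered fundamental group of the curve `C` (the `k`-core) -/
  eC : C.PiTemp ≃ₜ* toCoreData.PiCRef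
  /-- the reference inclusion IS `Π^tp_{X̲̲_k} ⊆ Π^tp_{C_k}` (successor predicate) -/
  refIsCore : toCoreData.RefIsCore X C eX eC

end Literature.IUT.HodgeArakelov
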